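import Mathlib
import HarnessLib
import Summits.HubbardSuperconductivity.HubbardSuperconductivity.Theorems.KLProgrammeKLRegimeSplitLegCount
import Literature.MathematicalPhysics.QuantumLattice.HubbardFreeCovariance

/-!
# K3 gen-8-FLOW (stmt 20437, stub (C), «(C)-B» doors): the two READING-POINT hypotheses of the (B) doors, discharged by the scale ladder

Cell gate-hubbard-kl, seat p2 g16.  The frame-response (B) doors come in two forms: for `m ≤ n_β − 1` the door of record
`…SupFlowTablesGN._aliasing_gevrey_numeral4` asks that the reading point lie BELOW BOTH SHELLS,
`hq₂ : (π/β)² + e_{K_{m+1}}(q)² < Λ_m²/4`, `hq₁ : (π/β)² + e_{K_m}(q)² < Λ_m²/4`; at the last step `m = n_β` the graded doors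
(`…SupFlowGradedTablesGN[Small]`) ask instead `hωΛ : Λ_m/4 ≤ |ω_i|` for the two reading frequencies.  Both are pure ladder arithmetic
(`π/β ≤ Λ_{n_β} < 4π/β`, `Λ_{m+1} = Λ_m/4`, `π/β ≤ |ω_i|`, the ladder's antitonicity `klld_klScale_anti`); this file records them once, in real-number form, so the (P) closer plugs
`e₁ = e_{K_{m+1}}(γθ) = 0` (curve point) and `|e₀| = |e_{K_m}(γθ)| ≤ fd ≤ Λ_m/4` (frame distance):

* `klScale_div_four_le_abs_matsubaraFreq_of_nScales_le` — `n_β ≤ m ⇒ Λ_m/4 ≤ |ω_i|` for every Matsubara index (the last-step doors' `hωΛ`);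
* `pi_div_le_klScale_div_four_of_succ_le_nScales` — `m + 1 ≤ n_β ⇒ π/β ≤ Λ_m/4`;
* **`readingPoint_below_shells_of_succ_le_nScales`** — `m + 1 ≤ n_β`, `e₁ = 0`, `|e₀| ≤ Λ_m/4` ⇒
  `(π/β)² + e₁² < Λ_m²/4 ∧ (π/β)² + e₀² < Λ_m²/4` (the non-last doors' `hq₂ ∧ hq₁`).

Pure real arithmetic on the tree's `klScale`/`nScales`; no definitions; nothing asserts superconductivity.  References: BGM 2006 §2.3 (2.31a), (2.38)
[cite: BenfattoGiulianiMastropietro2006].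
-/

noncomputable section

namespace Summit.HubbardSuperconductivity.HubbardSuperconductivity.Theorems.EngineV8

set_option linter.dupNamespace false -- summit = problem name (single-conjunct summit), D-0017

open Real Literature.MathematicalPhysics.QuantumLattice
open Summit.HubbardSuperconductivity.HubbardSuperconductivity.Theorems.KLRegimeSplit
open Summit.HubbardSuperconductivity.HubbardSuperconductivity.Theorems.KLProgrammeLegKernels

/-- **The last-step doors' frequency hypothesis**: for `n_β ≤ m` and `0 < β`, `Λ_m/4 ≤ |ω_i|` for every Matsubara index `i`
(`Λ_m ≤ Λ_{n_β} < 4π/β`, `π/β ≤ |ω_i|`). [cite: BenfattoGiulianiMastropietro2006, §2.3 (2.38)] -/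
theorem klScale_div_four_le_abs_matsubaraFreq_of_nScales_le {β : ℝ} (hβ : 0 < β) {m : ℕ} (hm : nScales β ≤ m) {M : ℕ}
    (i : MatsubaraIdx M) : klScale klE0 m / 4 ≤ |matsubaraFreq β M i| := by
  have h1 : klScale klE0 m ≤ klScale klE0 (nScales β) := klld_klScale_anti hm
  have h2 := klth_klScale_nScales_lt hβ
  have h3 := pi_div_le_abs_matsubaraFreq hβ i
  linarith

/-- `m + 1 ≤ n_β ⇒ π/β ≤ Λ_m/4` (`π/β ≤ Λ_{n_β} ≤ Λ_{m+1} = Λ_m/4`). [cite: BenfattoGiulianiMastropietro2006, §2.3 (2.38)] -/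
theorem pi_div_le_klScale_div_four_of_succ_le_nScales {β : ℝ} (hβ : klBetaMin ≤ β) {m : ℕ} (hm : m + 1 ≤ nScales β) :
    Real.pi / β ≤ klScale klE0 m / 4 := by
  have h1 := klth_pi_div_le_klScale_nScales hβ
  have h2 : klScale klE0 (nScales β) ≤ klScale klE0 (m + 1) := klld_klScale_anti hm
  rw [← klth_klScale_succ]
  exact h1.trans h2

/-- **The non-last doors' reading-point hypotheses**: for `m + 1 ≤ n_β` (so `π/β ≤ Λ_m/4`), a curve point of the new frame
(`e₁ = e_{K_{m+1}}(q) = 0`) whose old level is within the frame distance (`|e₀| = |e_{K_m}(q)| ≤ Λ_m/4`) lies below both scale-`m` shells: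
`(π/β)² + e₁² < Λ_m²/4` and `(π/β)² + e₀² < Λ_m²/4`. [cite: BenfattoGiulianiMastropietro2006, §2.3 (2.38)] -/
theorem readingPoint_below_shells_of_succ_le_nScales {β : ℝ} (hβ : klBetaMin ≤ β) {m : ℕ} (hm : m + 1 ≤ nScales β)
    {e₀ e₁ : ℝ} (he₁ : e₁ = 0) (he₀ : |e₀| ≤ klScale klE0 m / 4) :
    (Real.pi / β) ^ 2 + e₁ ^ 2 < (klScale klE0 m) ^ 2 / 4 ∧ (Real.pi / β) ^ 2 + e₀ ^ 2 < (klScale klE0 m) ^ 2 / 4 := by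
  have hΛ : 0 < klScale klE0 m := klth_klScale_pos m
  have hβ0 : 0 < β := pos_of_klBetaMin_le hβ
  have hπβ : 0 < Real.pi / β := by positivity
  have h1 := pi_div_le_klScale_div_four_of_succ_le_nScales hβ hm
  have hsq1 : (Real.pi / β) ^ 2 ≤ (klScale klE0 m / 4) ^ 2 := pow_le_pow_left₀ hπβ.le h1 2
  have hsq0 : e₀ ^ 2 ≤ (klScale klE0 m / 4) ^ 2 := by
    rw [← sq_abs e₀]; exact pow_le_pow_left₀ (abs_nonneg _) he₀ 2
  subst he₁
  constructor
  · nlinarith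
  · nlinarith

end Summit.HubbardSuperconductivity.HubbardSuperconductivity.Theorems.EngineV8

end
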